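/-
Copyright: the b2b-balaban T⁴-continuum CRUX team, row NE7b OWNER lineage `t4-ne7b-p1` (gen 121). Project licence.
-/
import Summits.QuantumFields.BalabanUV.T4Continuum.Spine.NE7b.SupTorusCovarianceLocality

/-!
# THE LOCALITY COLUMN ON THE BLOCK-AVERAGE CLASS: the coarse floor `⟨g, Tg⟩ ≥ Σg²∕(36^d(4d + a + Λ))`, hence the exponential locality of
# the next-scale Hessian `(n+1)^dT⁻¹` and of the fluctuation covariance `H⁻¹ − H⁻¹Q′t*T⁻¹Q′tH⁻¹`, hold for EVERY potential `V ≥ −λ` whose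
# BLOCK SUMS of `V₊` are `≤ Λ(n+1)^d` — no pointwise ceiling (`φ⁴`-type `u″∘φ` on fields with bounded block mean squares is IN); constants
# `(d, a, λ, Λ)` only, every mesh, every volume; § [NE7bP1-G120-HANDOFF-FINAL] NEXT (3)(c) «the one-sided (`φ⁴`) class: the floor (135) uses
# `V ≤ Λ` only through `ΣVΦ² ≤ Λ(n+1)^dΣg²`» DONE in its block-average form (row NE7b, node U5c; (131)–(139) BY NAME; [folklore])

Cell `pub-balaban`, sub-cell `t4`, spine estimate NE7b (`T4WeightBudget.RelWeightBound`; the cell's OWN estimate — NOT PRINTED in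
[Bałaban 1983–89], NOT PROVED).  Crux-route work under `Spine/NE7b/` by the row OWNER (`t4-ne7b-p1` gen 121, file (140)) under FREEZE
(0)'s crux-prover clause; NOTHING of Bałaban's is named as a Lean object, valued or asserted; no `T4Continuum/Support` leaf typed; no `def`,
no notation; zero `sorry`.  Imports (BY NAME): the OWNER's (139) `…SupTorusCovarianceLocality` (`covariance_local_of_floor`; through it (135)
`sum_blockLift_mul_F`, `blockSum_F`, `sum_bond_sq_le`, `variational`, (134) `schur_inverse_decay`, (133) `action_sum_smul`, (131) `exists_rate`,
(130) `torus_form_split`, (89) TDF `sum_blockLift_mul`), the Literature column `B6QGQLower276` (`F`, `bump`, `bump_nonneg`, `bump_le_one`,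
`Theta1`, `Theta1_div_ge`, `Theta1_div_le`, `card_cube`).

WHY (located).  (135) `coarse_floor` uses the pointwise ceiling `V ≤ Λ` at exactly one place: the potential term `Σ_x V x·Φ(x)²` of the form
of [B6]'s test function `Φ = g(bt ·)·bump(wm ·)`.  Since `0 ≤ bump ≤ 1`, `Σ_x V x·Φ² ≤ Σ_x V₊ x·g(bt x)² = Σ_y g y²·Σ_{B_y}V₊ ≤ Λ(n+1)^dΣg²` as
soon as every BLOCK SUM of `V₊` is `≤ Λ(n+1)^d` — a condition on block averages, the currency of the block-spin constraint itself, strictly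
weaker than the two-sided class (§1 `blockAvg_of_le`).  Everything downstream — (134) `schur_inverse_decay` (needs `V ≥ −λ` and the floor),
(139) `covariance_local_of_floor` (the same) — is already floor-parametrised, so the block-average class inherits the whole locality column.

WHAT IS PROVED ([folklore]; fine torus `Site d ((n+1)s)`, coarse `Site d s`, `[NeZero s]`; the action DISPLAYED; `bt x = σ_s(blk n (wm x))`;
`T(y,y′) = (n+1)^{−d}Σ_z ψ_{y′}(σ(chart (wm y) z))` for columns `Hψ_{y′} = 𝟙[bt · = y′]`; the class: `V ≥ −λ` and
`∀ y, Σ_z max(V(σ(chart (wm y) z)), 0) ≤ Λ(n+1)^d`):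
* §1 **`sum_V_F_sq_le_of_blockAvg`** (`Σ_x V x·F(wm x)² ≤ Λ(n+1)^dΣ_y g y²`), `blockAvg_of_le` (`V ≤ Λ`, `Λ ≥ 0` ⟹ the block-average letter).
* §2 `coarseForm_eq_pairing` (`Σ_y g y Σ_{y′}T(y,y′)g y′ = (n+1)^{−d}Σ_x g(bt x)Ψ x`, `Ψ = Σ_{y′}g y′ψ_{y′}`), **`pairing_floor_of_blockAvg`**
  (`a > 0`, `λ ≤ min(2,a)`, `Λ ≥ 0`, the class: `(n+1)^dΣg²∕(36^d(4d + a + Λ)) ≤ Σ_x g(bt x)Ψ x` — (135)'s variational proof with the potential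
  term read by §1; together: the coarse floor `⟨g,Tg⟩ ≥ Σg²∕(36^d(4d + a + Λ))` on the class).
* §3 **`nextScale_hessian_local_of_blockAvg`** (`∃ c₁ δ₁ > 0` from `(d, a, λ, Λ)`: `|T⁻¹(y,y′)| ≤ c₁e^{−δ₁ρ_s(y,y′)}` on the class, every mesh and
  volume), **`covariance_local_of_blockAvg`** (`∃ C δ > 0` from `(d, a, λ, Λ)`: (i)–(iii) of (139) `covariance_local_of_floor` on the class).
* §4 toy.

HONEST (what this is NOT).  The class is still a CEILING (on block averages of `V₊`): an unbounded potential with unbounded block averages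
has no uniform floor (`T → 0` as `V → ∞`), so this is the natural form, not a removal, of the upper condition; the response headline (137)
`response_local` is two-sided as filed (its lemma `blockSq_le_of_decaying_source` + §3 give the class version in three lines, not typed);
nothing pointwise (no `ℓ^∞` theory); constants explicit, far from sharp; cubic periods; scalar skeleton ((A3), NC-NE7b-α UNRULED); nothing of
Bałaban's.  BY-NAME EFFECT ON THE WALL: NONE.  NE7b NOT PRINTED ∕ NOT PROVED; spine PROVED 0∕9; rung (B)+1 on a FINITE torus — NOT infinite
volume, NOT the mass gap, NOT Clay.  HONEST DEPENDENCY: continuum YM on T⁴ ⇐ BetaPertH ∧ nine spine estimates (0∕9 proved); BetaPertH ⇐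
(D1) ∧ (D4) ∧ CAP+tail; G-an2-4 gates asym, D1 and NE2∕3∕4.
-/

set_option autoImplicit false

noncomputable section

namespace Summit.QuantumFields.BalabanUV.T4Continuum.NE7b.SupTorusCoarseFloorBlockAvg

open Real
open Literature.MathematicalPhysics.QuantumFieldTheory.Balaban1983to89
open B6QGQLower276 (X e blk B side chart mem_B sum_B sum_B_const card_cube blk_chart bump bump_nonneg bump_le_one F
  Theta1 Theta1_div_ge Theta1_div_le Theta1_nonneg)
open Beta (Site siteOf windowMap siteOf_windowMap siteOf_add)
open SupTorusDirichletForm (sum_blockLift_mul blockOf_siteOf_of_mem)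
open SupTorusConjugatedForm (torus_form_split)
open SupTorusActionForm (action_sum_smul)
open SupTorusHessianCombesThomas (exists_rate)
open SupTorusSchurComplement (schur_inverse_decay)
open SupTorusCoarseFloor (sum_blockLift_mul_F blockSum_F sum_bond_sq_le variational)
open SupTorusCovarianceLocality (covariance_local_of_floor)

variable {d : ℕ}

/-! ## §1. The potential term of the test function under a block-average ceiling -/

section Potential

variable (n s : ℕ) [NeZero s]

/-- **THE POTENTIAL TERM OF [B6]'s TEST FUNCTION NEEDS ONLY BLOCK AVERAGES OF `V₊`**: if every torus block carries
`Σ_z max(V(σ(chart (wm y) z)), 0) ≤ Λ·(n+1)^d`, then for `F = g(bt ·)·bump(wm ·)`: `Σ_x V x·F(wm x)² ≤ Λ(n+1)^d·Σ_y g y²` (`0 ≤ bump ≤ 1`, the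
block lift pairs blockwise). [folklore] -/
theorem sum_V_F_sq_le_of_blockAvg (V : Site d ((n + 1) * s) → ℝ) {Lam : ℝ}
    (hVavg : ∀ y : Site d s, ∑ z : Fin d → Fin (n + 1), max (V (siteOf d ((n + 1) * s) (chart n (windowMap d s y) z))) 0
      ≤ Lam * ((n : ℝ) + 1) ^ d) (g : Site d s → ℝ) :
    ∑ x : Site d ((n + 1) * s), V x * (F n (fun q => g (siteOf d s q)) (windowMap d ((n + 1) * s) x)
        * F n (fun q => g (siteOf d s q)) (windowMap d ((n + 1) * s) x))
      ≤ Lam * ((n : ℝ) + 1) ^ d * ∑ y, g y ^ 2 := by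
  classical
  -- pointwise: `V·F² ≤ V₊·g(bt ·)²`
  have hpt : ∀ x : Site d ((n + 1) * s), V x * (F n (fun q => g (siteOf d s q)) (windowMap d ((n + 1) * s) x)
        * F n (fun q => g (siteOf d s q)) (windowMap d ((n + 1) * s) x))
      ≤ g (siteOf d s (blk n (windowMap d ((n + 1) * s) x))) ^ 2 * max (V x) 0 := by
    intro x
    have hF : F n (fun q => g (siteOf d s q)) (windowMap d ((n + 1) * s) x)
        = g (siteOf d s (blk n (windowMap d ((n + 1) * s) x))) * bump n (windowMap d ((n + 1) * s) x) := rfl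
    have hb0 := bump_nonneg n (windowMap d ((n + 1) * s) x)
    have hb1 := bump_le_one n (windowMap d ((n + 1) * s) x)
    have hb2 : bump n (windowMap d ((n + 1) * s) x) ^ 2 ≤ 1 := by nlinarith
    have hF2 : F n (fun q => g (siteOf d s q)) (windowMap d ((n + 1) * s) x) * F n (fun q => g (siteOf d s q)) (windowMap d ((n + 1) * s) x)
        ≤ g (siteOf d s (blk n (windowMap d ((n + 1) * s) x))) ^ 2 := by
      rw [hF, ← sq, mul_pow]
      exact (mul_le_mul_of_nonneg_left hb2 (sq_nonneg _)).trans (le_of_eq (mul_one _))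
    have hF0 : 0 ≤ F n (fun q => g (siteOf d s q)) (windowMap d ((n + 1) * s) x)
        * F n (fun q => g (siteOf d s q)) (windowMap d ((n + 1) * s) x) := mul_self_nonneg _
    calc V x * (F n (fun q => g (siteOf d s q)) (windowMap d ((n + 1) * s) x)
          * F n (fun q => g (siteOf d s q)) (windowMap d ((n + 1) * s) x))
        ≤ max (V x) 0 * (F n (fun q => g (siteOf d s q)) (windowMap d ((n + 1) * s) x)
          * F n (fun q => g (siteOf d s q)) (windowMap d ((n + 1) * s) x)) := mul_le_mul_of_nonneg_right (le_max_left _ _) hF0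
      _ ≤ max (V x) 0 * g (siteOf d s (blk n (windowMap d ((n + 1) * s) x))) ^ 2 := mul_le_mul_of_nonneg_left hF2 (le_max_right _ _)
      _ = _ := mul_comm _ _
  refine (Finset.sum_le_sum fun x _ => hpt x).trans ?_
  rw [sum_blockLift_mul n s (fun y => g y ^ 2) (fun x => max (V x) 0)]
  calc ∑ y : Site d s, g y ^ 2 * ∑ p ∈ B n (windowMap d s y), max (V (siteOf d ((n + 1) * s) p)) 0
      ≤ ∑ y : Site d s, g y ^ 2 * (Lam * ((n : ℝ) + 1) ^ d) := by
        refine Finset.sum_le_sum fun y _ => mul_le_mul_of_nonneg_left ?_ (sq_nonneg _)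
        rw [sum_B]
        exact hVavg y
    _ = Lam * ((n : ℝ) + 1) ^ d * ∑ y, g y ^ 2 := by rw [← Finset.sum_mul]; ring

/-- The two-sided class is INSIDE the block-average class: `V ≤ Λ` pointwise with `Λ ≥ 0` ⟹ every block sum of `V₊` is `≤ Λ(n+1)^d`.
[folklore] -/
theorem blockAvg_of_le (V : Site d ((n + 1) * s) → ℝ) {Lam : ℝ} (hLam : 0 ≤ Lam) (hV' : ∀ x, V x ≤ Lam) (y : Site d s) :
    ∑ z : Fin d → Fin (n + 1), max (V (siteOf d ((n + 1) * s) (chart n (windowMap d s y) z))) 0 ≤ Lam * ((n : ℝ) + 1) ^ d := by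
  calc ∑ z : Fin d → Fin (n + 1), max (V (siteOf d ((n + 1) * s) (chart n (windowMap d s y) z))) 0
      ≤ ∑ _z : Fin d → Fin (n + 1), Lam := Finset.sum_le_sum fun z _ => max_le (hV' _) hLam
    _ = Lam * ((n : ℝ) + 1) ^ d := by rw [Finset.sum_const, Finset.card_univ, nsmul_eq_mul, card_cube, mul_comm]

end Potential

/-! ## §2. The coarse floor on the block-average class -/

section Floor

variable (n : ℕ) (a : ℝ) (s : ℕ) [NeZero s] (ha : 0 < a) {lam Lam : ℝ} (hlam : lam ≤ min 2 a) (hLam : 0 ≤ Lam)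
  (V : Site d ((n + 1) * s) → ℝ) (hV : ∀ x, -lam ≤ V x)
  (hVavg : ∀ y : Site d s, ∑ z : Fin d → Fin (n + 1), max (V (siteOf d ((n + 1) * s) (chart n (windowMap d s y) z))) 0
    ≤ Lam * ((n : ℝ) + 1) ^ d)
  (ψ : Site d s → Site d ((n + 1) * s) → ℝ)
  (hψ : ∀ y' x, ((n : ℝ) + 1) ^ 2 * ∑ μ, (2 * ψ y' x - ψ y' (x + siteOf d ((n + 1) * s) (e μ)) - ψ y' (x - siteOf d ((n + 1) * s) (e μ)))
      + a / ((n : ℝ) + 1) ^ d * ∑ q ∈ B n (blk n (windowMap d ((n + 1) * s) x)), ψ y' (siteOf d ((n + 1) * s) q) + V x * ψ y' x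
      = if siteOf d s (blk n (windowMap d ((n + 1) * s) x)) = y' then 1 else 0)

/-- **THE COARSE FORM IS A FINE PAIRING**: with `Ψ = Σ_{y′} g y′·ψ_{y′}` (so `HΨ = g∘bt`),
`Σ_y g y·Σ_{y′}T(y,y′)g y′ = (n+1)^{−d}·Σ_x g(bt x)·Ψ x` — (135)'s step (P2) as a named identity. [folklore] -/
theorem coarseForm_eq_pairing (g : Site d s → ℝ) :
    ∑ y, g y * ∑ y', ((((n : ℝ) + 1) ^ d)⁻¹ * ∑ z : Fin d → Fin (n + 1), ψ y' (siteOf d ((n + 1) * s) (chart n (windowMap d s y) z))) * g y'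
      = (((n : ℝ) + 1) ^ d)⁻¹ * ∑ x, g (siteOf d s (blk n (windowMap d ((n + 1) * s) x))) * ∑ y', g y' * ψ y' x := by
  classical
  rw [sum_blockLift_mul n s g (fun x => ∑ y', g y' * ψ y' x), Finset.mul_sum]
  refine Finset.sum_congr rfl fun y _ => ?_
  rw [sum_B (windowMap d s y) (fun p => ∑ y', g y' * ψ y' (siteOf d ((n + 1) * s) p))]
  have hin : ∑ y', ((((n : ℝ) + 1) ^ d)⁻¹
        * ∑ z : Fin d → Fin (n + 1), ψ y' (siteOf d ((n + 1) * s) (chart n (windowMap d s y) z))) * g y'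
      = (((n : ℝ) + 1) ^ d)⁻¹ * ∑ z : Fin d → Fin (n + 1), ∑ y', g y' * ψ y' (siteOf d ((n + 1) * s) (chart n (windowMap d s y) z)) := by
    calc ∑ y', ((((n : ℝ) + 1) ^ d)⁻¹ * ∑ z : Fin d → Fin (n + 1), ψ y' (siteOf d ((n + 1) * s) (chart n (windowMap d s y) z))) * g y'
        = ∑ y', ∑ z : Fin d → Fin (n + 1), (((n : ℝ) + 1) ^ d)⁻¹ * (g y' * ψ y' (siteOf d ((n + 1) * s) (chart n (windowMap d s y) z))) :=
          Finset.sum_congr rfl fun y' _ => by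
            rw [mul_comm, ← mul_assoc, Finset.mul_sum]
            exact Finset.sum_congr rfl fun z _ => by ring
      _ = ∑ z : Fin d → Fin (n + 1), ∑ y', (((n : ℝ) + 1) ^ d)⁻¹ * (g y' * ψ y' (siteOf d ((n + 1) * s) (chart n (windowMap d s y) z))) :=
          Finset.sum_comm
      _ = _ := by
          rw [Finset.mul_sum]
          exact Finset.sum_congr rfl fun z _ => (Finset.mul_sum _ _ _).symm
  rw [hin]
  ring

include ha hlam hLam hV hVavg hψ in
/-- **THE FLOOR ON THE BLOCK-AVERAGE CLASS, IN THE FINE PAIRING**: for `H = (n+1)²(−Δ) + a(n+1)^{−d}(block sums) + V` with `V ≥ −λ`,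
`λ ≤ min(2,a)`, `a > 0` and the block sums of `V₊` at most `Λ(n+1)^d` (NO pointwise ceiling), `Ψ = Σ_{y′}g y′ψ_{y′}` satisfies
`(n+1)^d·Σ_y g y²∕(36^d(4d + a + Λ)) ≤ Σ_x g(bt x)·Ψ x` for EVERY coarse `g` — (135) `coarse_floor`'s variational argument with its potential
term read by §1 `sum_V_F_sq_le_of_blockAvg`; with `coarseForm_eq_pairing` this is the coarse floor `⟨g,Tg⟩ ≥ Σg²∕(36^d(4d + a + Λ))`. [folklore] -/
theorem pairing_floor_of_blockAvg (g : Site d s → ℝ) :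
    ((n : ℝ) + 1) ^ d * (1 / ((36 : ℝ) ^ d * (4 * d + a + Lam)) * ∑ y, g y ^ 2)
      ≤ ∑ x, g (siteOf d s (blk n (windowMap d ((n + 1) * s) x))) * ∑ y', g y' * ψ y' x := by
  classical
  have hvol : (0 : ℝ) < ((n : ℝ) + 1) ^ d := by positivity
  have hn : (0 : ℝ) < (n : ℝ) + 1 := by positivity
  have hd : (0 : ℝ) ≤ d := Nat.cast_nonneg d
  set Ψ : Site d ((n + 1) * s) → ℝ := fun x => ∑ y', g y' * ψ y' x with hΨdef
  set Fb : Site d ((n + 1) * s) → ℝ := fun x => F n (fun q => g (siteOf d s q)) (windowMap d ((n + 1) * s) x) with hFb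
  -- (P1) `HΨ = g ∘ bt`
  have hΨ : ∀ x, ((n : ℝ) + 1) ^ 2 * ∑ μ, (2 * Ψ x - Ψ (x + siteOf d ((n + 1) * s) (e μ)) - Ψ (x - siteOf d ((n + 1) * s) (e μ)))
      + a / ((n : ℝ) + 1) ^ d * ∑ q ∈ B n (blk n (windowMap d ((n + 1) * s) x)), Ψ (siteOf d ((n + 1) * s) q) + V x * Ψ x
      = g (siteOf d s (blk n (windowMap d ((n + 1) * s) x))) := by
    intro x
    simp only [hΨdef]
    rw [action_sum_smul n a s Finset.univ g ψ V x]
    simp only [hψ, mul_ite, mul_one, mul_zero]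
    rw [Finset.sum_ite_eq, if_pos (Finset.mem_univ _)]
  -- (P3) variational inequality with `t₀ = 6^{−d}∕(4d + a + Λ)`
  set t₀ : ℝ := (1 / 6 : ℝ) ^ d / (4 * d + a + Lam) with ht₀
  have ht₀0 : 0 ≤ t₀ := by positivity
  have hvar := variational n a s V Ψ (fun x => g (siteOf d s (blk n (windowMap d ((n + 1) * s) x)))) Fb hlam hV hΨ t₀
  -- (P4) the pairing; (P5) the form of the test function
  have hpair : ∑ x, g (siteOf d s (blk n (windowMap d ((n + 1) * s) x))) * Fb x = Theta1 n ^ d * ∑ y, g y ^ 2 := sum_blockLift_mul_F n s g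
  have hsplit := torus_form_split n a s Fb
  have hL : ((n : ℝ) + 1) ^ 2 * ∑ μ : Fin d, ∑ x, (Fb (x + siteOf d ((n + 1) * s) (e μ)) - Fb x) ^ 2
      ≤ 4 * d * ((n : ℝ) + 1) ^ d * ∑ y, g y ^ 2 := by
    have h1 := Finset.sum_le_sum fun μ (_ : μ ∈ (Finset.univ : Finset (Fin d))) => sum_bond_sq_le n s g μ
    rw [Finset.sum_const, Finset.card_univ, Fintype.card_fin, nsmul_eq_mul] at h1
    exact (mul_le_mul_of_nonneg_left h1 (by positivity)).trans (le_of_eq (by field_simp))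
  have hB : a / ((n : ℝ) + 1) ^ d * ∑ y : Site d s, (∑ z : Fin d → Fin (n + 1), Fb (siteOf d ((n + 1) * s) (chart n (windowMap d s y) z))) ^ 2
      ≤ a * ((n : ℝ) + 1) ^ d * ∑ y, g y ^ 2 := by
    simp only [hFb, blockSum_F n s g, mul_pow, ← Finset.sum_mul]
    have hΘ : Theta1 n ^ d ≤ ((n : ℝ) + 1) ^ d := pow_le_pow_left₀ (Theta1_nonneg n) ((div_le_one hn).1 (Theta1_div_le n)) d
    have hS : 0 ≤ ∑ y, g y ^ 2 := Finset.sum_nonneg fun _ _ => sq_nonneg _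
    rw [div_mul_eq_mul_div, div_le_iff₀ hvol]
    have : (Theta1 n ^ d) ^ 2 ≤ ((n : ℝ) + 1) ^ d * ((n : ℝ) + 1) ^ d := by nlinarith [pow_nonneg (Theta1_nonneg n) d]
    nlinarith [mul_le_mul_of_nonneg_left this (mul_nonneg ha.le hS)]
  have hVt : ∑ x, V x * (Fb x * Fb x) ≤ Lam * ((n : ℝ) + 1) ^ d * ∑ y, g y ^ 2 := sum_V_F_sq_le_of_blockAvg n s V hVavg g
  have hformF : ∑ x, Fb x * (((n : ℝ) + 1) ^ 2 * ∑ μ, (2 * Fb x - Fb (x + siteOf d ((n + 1) * s) (e μ))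
        - Fb (x - siteOf d ((n + 1) * s) (e μ))) + a / ((n : ℝ) + 1) ^ d * ∑ q ∈ B n (blk n (windowMap d ((n + 1) * s) x)),
          Fb (siteOf d ((n + 1) * s) q) + V x * Fb x)
      ≤ (4 * d + a + Lam) * ((n : ℝ) + 1) ^ d * ∑ y, g y ^ 2 := by
    have e : ∑ x, Fb x * (((n : ℝ) + 1) ^ 2 * ∑ μ, (2 * Fb x - Fb (x + siteOf d ((n + 1) * s) (e μ))
        - Fb (x - siteOf d ((n + 1) * s) (e μ))) + a / ((n : ℝ) + 1) ^ d * ∑ q ∈ B n (blk n (windowMap d ((n + 1) * s) x)),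
          Fb (siteOf d ((n + 1) * s) q) + V x * Fb x)
      = ∑ x, Fb x * (((n : ℝ) + 1) ^ 2 * ∑ μ, (2 * Fb x - Fb (x + siteOf d ((n + 1) * s) (e μ))
        - Fb (x - siteOf d ((n + 1) * s) (e μ))) + a / ((n : ℝ) + 1) ^ d * ∑ q ∈ B n (blk n (windowMap d ((n + 1) * s) x)),
          Fb (siteOf d ((n + 1) * s) q)) + ∑ x, V x * (Fb x * Fb x) := by
      rw [← Finset.sum_add_distrib]; exact Finset.sum_congr rfl fun x _ => by ring
    rw [e, hsplit]
    linarith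
  -- (P6) the scalar optimisation at `t₀ = σ∕D`, `σ = 6^{−d}`, `D = 4d + a + Λ`
  have hΘlo : ((n : ℝ) + 1) ^ d * (1 / 6 : ℝ) ^ d ≤ Theta1 n ^ d := by
    rw [← mul_pow]
    refine pow_le_pow_left₀ (by positivity) ?_ d
    have := Theta1_div_ge n; rw [le_div_iff₀ hn] at this; linarith
  have hS : 0 ≤ ∑ y, g y ^ 2 := Finset.sum_nonneg fun _ _ => sq_nonneg _
  set σ : ℝ := (1 / 6 : ℝ) ^ d with hσ
  have hσσ : σ * σ = 1 / (36 : ℝ) ^ d := by rw [hσ, ← mul_pow, show (1 / 6 : ℝ) * (1 / 6) = 1 / 36 by norm_num, one_div_pow]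
  rw [hpair] at hvar
  have h1 : 2 * t₀ * (((n : ℝ) + 1) ^ d * σ * ∑ y, g y ^ 2) ≤ 2 * t₀ * (Theta1 n ^ d * ∑ y, g y ^ 2) :=
    mul_le_mul_of_nonneg_left (mul_le_mul_of_nonneg_right hΘlo hS) (by positivity)
  have h2 := mul_le_mul_of_nonneg_left hformF (sq_nonneg t₀)
  have h3 : ((n : ℝ) + 1) ^ d * (1 / ((36 : ℝ) ^ d * (4 * d + a + Lam)) * ∑ y, g y ^ 2)
      = 2 * t₀ * (((n : ℝ) + 1) ^ d * σ * ∑ y, g y ^ 2) - t₀ ^ 2 * ((4 * d + a + Lam) * ((n : ℝ) + 1) ^ d * ∑ y, g y ^ 2) := by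
    rw [show (1 : ℝ) / ((36 : ℝ) ^ d * (4 * d + a + Lam)) = σ * σ / (4 * d + a + Lam) by
      rw [← one_div_mul_one_div, ← hσσ]; ring, ht₀]
    field_simp
    ring
  rw [h3]; linarith

end Floor

/-! ## §3. THE END on the block-average class: the next-scale Hessian and the fluctuation covariance are exponentially local -/

/-- **THE NEXT-SCALE HESSIAN IS EXPONENTIALLY LOCAL ON THE BLOCK-AVERAGE CLASS, UNCONDITIONALLY.**  Fix `d`, `a > 0`, `λ < min(2,a)`,
`Λ ≥ 0`.  THERE ARE `c₁, δ₁ > 0` (functions of these only) such that on EVERY pair of tori, for EVERY potential `V ≥ −λ` whose block sums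
of `V₊` are `≤ Λ(n+1)^d` (e.g. `u″∘φ` for `φ⁴`-type `u` on fields with bounded block mean squares — no pointwise ceiling) and the block columns
`ψ_{y′}` of `H⁻¹`: `|T⁻¹(y,y′)| ≤ c₁e^{−δ₁ρ_s(y,y′)}`.  (131) `exists_rate` ∘ (134) `schur_inverse_decay` ∘ §2. [folklore] -/
theorem nextScale_hessian_local_of_blockAvg (a : ℝ) (ha : 0 < a) {lam Lam : ℝ} (hm0 : 0 < min 2 a - lam) (hLam : 0 ≤ Lam) :
    ∃ c₁ δ₁ : ℝ, 0 < c₁ ∧ 0 < δ₁ ∧ ∀ (n s : ℕ) [NeZero s] (V : Site d ((n + 1) * s) → ℝ), (∀ x, -lam ≤ V x) →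
      (∀ y : Site d s, ∑ z : Fin d → Fin (n + 1), max (V (siteOf d ((n + 1) * s) (chart n (windowMap d s y) z))) 0
        ≤ Lam * ((n : ℝ) + 1) ^ d) →
      ∀ ψ : Site d s → Site d ((n + 1) * s) → ℝ,
      (∀ y' x, ((n : ℝ) + 1) ^ 2 * ∑ μ, (2 * ψ y' x - ψ y' (x + siteOf d ((n + 1) * s) (e μ)) - ψ y' (x - siteOf d ((n + 1) * s) (e μ)))
        + a / ((n : ℝ) + 1) ^ d * ∑ q ∈ B n (blk n (windowMap d ((n + 1) * s) x)), ψ y' (siteOf d ((n + 1) * s) q) + V x * ψ y' x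
        = if siteOf d s (blk n (windowMap d ((n + 1) * s) x)) = y' then 1 else 0) →
      ∀ y y' : Site d s,
        |(Matrix.of fun y y' : Site d s =>
            (((n : ℝ) + 1) ^ d)⁻¹ * ∑ z : Fin d → Fin (n + 1), ψ y' (siteOf d ((n + 1) * s) (chart n (windowMap d s y) z)))⁻¹ y y'|
          ≤ c₁ * exp (-(δ₁ * ∑ i, (((y i - y' i).valMinAbs.natAbs : ℕ) : ℝ))) := by
  obtain ⟨κ, hκ0, hκ1, hκm⟩ := exists_rate (d := d) a ha.le hm0
  have hm : 0 < min 2 a - lam - 2 * d * κ ^ 2 - a * (exp (2 * d * κ) - 1) := by linarith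
  have hd : (0 : ℝ) ≤ d := Nat.cast_nonneg d
  have hγ : 0 < 1 / ((36 : ℝ) ^ d * (4 * d + a + Lam)) := by positivity
  obtain ⟨c₁, δ₁, hc₁, hδ₁, H⟩ := schur_inverse_decay (d := d) a ha.le hκ0 hκ1 hm hγ
  refine ⟨c₁, δ₁, hc₁, hδ₁, fun n s _ V hV hVavg ψ hψ y y' => H n s V hV ψ hψ (fun g => ?_) y y'⟩
  have hvol : (0 : ℝ) < ((n : ℝ) + 1) ^ d := by positivity
  rw [coarseForm_eq_pairing n s ψ g, inv_mul_eq_div]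
  exact (le_div_iff₀' hvol).2 (pairing_floor_of_blockAvg n a s ha (by linarith) hLam V hV hVavg ψ hψ g)

/-- **THE FLUCTUATION COVARIANCE IS EXPONENTIALLY LOCAL BLOCK-TO-BLOCK ON THE BLOCK-AVERAGE CLASS, UNCONDITIONALLY**: for `a > 0`,
`λ < min(2,a)`, `Λ ≥ 0` there are `C, δ > 0` depending on `(d, a, λ, Λ)` ONLY such that (i)–(iii) of (139) `covariance_local_of_floor` hold
for ALL `n, s`, ALL `V ≥ −λ` with block sums of `V₊` at most `Λ(n+1)^d`, ALL block columns `ψ`, every block `y₀`, every `Hu = f` with `f`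
supported in the block `y₀` — (139) at the floor of §2. [folklore] -/
theorem covariance_local_of_blockAvg (a : ℝ) (ha : 0 < a) {lam Lam : ℝ} (hm0 : 0 < min 2 a - lam) (hLam : 0 ≤ Lam) :
    ∃ C δ : ℝ, 0 < C ∧ 0 < δ ∧ ∀ (n s : ℕ) [NeZero s] (V : Site d ((n + 1) * s) → ℝ), (∀ x, -lam ≤ V x) →
      (∀ y : Site d s, ∑ z : Fin d → Fin (n + 1), max (V (siteOf d ((n + 1) * s) (chart n (windowMap d s y) z))) 0
        ≤ Lam * ((n : ℝ) + 1) ^ d) →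
      ∀ ψ : Site d s → Site d ((n + 1) * s) → ℝ,
      (∀ y' x, ((n : ℝ) + 1) ^ 2 * ∑ μ, (2 * ψ y' x - ψ y' (x + siteOf d ((n + 1) * s) (e μ)) - ψ y' (x - siteOf d ((n + 1) * s) (e μ)))
        + a / ((n : ℝ) + 1) ^ d * ∑ q ∈ B n (blk n (windowMap d ((n + 1) * s) x)), ψ y' (siteOf d ((n + 1) * s) q) + V x * ψ y' x
        = if siteOf d s (blk n (windowMap d ((n + 1) * s) x)) = y' then 1 else 0) →
      ∀ (y₀ : Site d s) (u f : Site d ((n + 1) * s) → ℝ), (∀ x, siteOf d s (blk n (windowMap d ((n + 1) * s) x)) ≠ y₀ → f x = 0) →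
      (∀ x, ((n : ℝ) + 1) ^ 2 * ∑ μ, (2 * u x - u (x + siteOf d ((n + 1) * s) (e μ)) - u (x - siteOf d ((n + 1) * s) (e μ)))
        + a / ((n : ℝ) + 1) ^ d * ∑ q ∈ B n (blk n (windowMap d ((n + 1) * s) x)), u (siteOf d ((n + 1) * s) q) + V x * u x = f x) →
        (∀ y : Site d s, ∑ z : Fin d → Fin (n + 1), u (siteOf d ((n + 1) * s) (chart n (windowMap d s y) z)) ^ 2
          ≤ C * exp (-(2 * δ * ∑ i, (((y i - y₀ i).valMinAbs.natAbs : ℕ) : ℝ))) * ∑ x, f x ^ 2) ∧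
        (∀ y : Site d s, (((n : ℝ) + 1) ^ d)⁻¹ * ∑ z : Fin d → Fin (n + 1), (u (siteOf d ((n + 1) * s) (chart n (windowMap d s y) z))
          - ∑ y', (∑ y'', (Matrix.of fun yy y'' : Site d s =>
              (((n : ℝ) + 1) ^ d)⁻¹ * ∑ z : Fin d → Fin (n + 1), ψ y'' (siteOf d ((n + 1) * s) (chart n (windowMap d s yy) z)))⁻¹ y' y''
            * ((((n : ℝ) + 1) ^ d)⁻¹ * ∑ z'' : Fin d → Fin (n + 1), u (siteOf d ((n + 1) * s) (chart n (windowMap d s y'') z''))))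
            * ψ y' (siteOf d ((n + 1) * s) (chart n (windowMap d s y) z))) = 0) ∧
        (∀ y : Site d s, ∑ z : Fin d → Fin (n + 1), (u (siteOf d ((n + 1) * s) (chart n (windowMap d s y) z))
          - ∑ y', (∑ y'', (Matrix.of fun yy y'' : Site d s =>
              (((n : ℝ) + 1) ^ d)⁻¹ * ∑ z : Fin d → Fin (n + 1), ψ y'' (siteOf d ((n + 1) * s) (chart n (windowMap d s yy) z)))⁻¹ y' y''
            * ((((n : ℝ) + 1) ^ d)⁻¹ * ∑ z'' : Fin d → Fin (n + 1), u (siteOf d ((n + 1) * s) (chart n (windowMap d s y'') z''))))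
            * ψ y' (siteOf d ((n + 1) * s) (chart n (windowMap d s y) z))) ^ 2
          ≤ C * exp (-(2 * δ * ∑ i, (((y i - y₀ i).valMinAbs.natAbs : ℕ) : ℝ))) * ∑ x, f x ^ 2) := by
  have hd : (0 : ℝ) ≤ d := Nat.cast_nonneg d
  have hγ : 0 < 1 / ((36 : ℝ) ^ d * (4 * d + a + Lam)) := by positivity
  obtain ⟨C, δ, hC, hδ, H⟩ := covariance_local_of_floor (d := d) a ha.le hm0 hγ
  refine ⟨C, δ, hC, hδ, fun n s _ V hV hVavg ψ hψ y₀ u f hf hu => H n s V hV ψ hψ (fun g => ?_) y₀ u f hf hu⟩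
  have hvol : (0 : ℝ) < ((n : ℝ) + 1) ^ d := by positivity
  rw [coarseForm_eq_pairing n s ψ g, inv_mul_eq_div]
  exact (le_div_iff₀' hvol).2 (pairing_floor_of_blockAvg n a s ha (by linarith) hLam V hV hVavg ψ hψ g)

/-! ## §4. Toy -/

/-- Toy (`d = 0`, `a = 1`, `λ = 0`, `Λ = 0`): the headline's hypotheses are inhabited, so the constants exist. -/
example : ∃ c₁ δ₁ : ℝ, 0 < c₁ ∧ 0 < δ₁ :=
  let ⟨c₁, δ₁, hc₁, hδ₁, _⟩ := nextScale_hessian_local_of_blockAvg (d := 0) 1 one_pos (lam := 0) (Lam := 0) (by norm_num) le_rfl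
  ⟨c₁, δ₁, hc₁, hδ₁⟩

end Summit.QuantumFields.BalabanUV.T4Continuum.NE7b.SupTorusCoarseFloorBlockAvg
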